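import Summits.ValiantsHypothesis.ValiantsHypothesis.Theorems.BarrierLeverSplitReductionSufficesForTransversal
import Summits.ValiantsHypothesis.ValiantsHypothesis.Theorems.BarrierLeverPriorityPeelingPairMove

/-!
# Route BarrierLever — priority peeling for TT: BASE CASES and SYMMETRIES of configurations

Helper file (`--supports stmt-ValiantsHypothesis-19152`; cell valiant-natproofs, rung V4, 𝒟-side;
prover gen 7; memo `HOME/prover/gen7/PP-MEMO-g7.md` §0/§5; companion of `…PriorityPeelingPairMove`
(`pairMove`) and `…PriorityPeelingShearMove` (`shearMove`)). Closes NO item.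

A configuration is a family of row index maps `R i : Fin e → Fin nr` and column index maps
`C j : Fin e → Fin nc` (`i, j : Fin r`); its layout matrix for `G` is `(det G[R i, C j])_{ij}` and it
is ALIVE when that is nonsingular for some `G`. NOTE (the TT adapter is the identity): for a TT
layout `(u, w)` of item 19152 the item's matrix IS the layout matrix of the configuration
`R i := fun a => if a ∈ u i then castAdd h a else natAdd h a`,
`C j := fun c => if c ∈ w j then natAdd h c else castAdd h c` (index maps `Fin h → Fin (h+h)`, no
sorting), so `pairMove` / `shearMove` apply to TT layouts verbatim (with `pos i = a` for the pair of
coordinate `a`), and all children along a peeling keep literal space `Fin (h+h)`.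

This file supplies the LEAVES and the SYMMETRIES of a peeling: `alive_of_injective` (one row,
any rank: a minor through injective index maps is nonsingular for a 0/1 matching matrix),
`alive_rank_zero` (rank 0: alive iff `r ≤ 1`), `alive_rank_one` (rank 1 with distinct row literals
and distinct column literals), `alive_transpose` (swap the roles of rows and columns: the column-pair
move is the row-pair move for `Gᵀ`), `alive_reindex` (re-index rows and columns of the layout).

WHAT THIS IS NOT: bookkeeping; nothing on the existence of peeling certificates, on TT / TNS / item
19717 in general, on crux stmt-ValiantsHypothesis-14610, or on `VP` versus `VNP`.
-/

-- layout Summits/ValiantsHypothesis/ValiantsHypothesis forces the duplicated namespace component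
set_option linter.dupNamespace false

namespace Summit.ValiantsHypothesis.ValiantsHypothesis.Theorems.BarrierLever.PriorityPeeling

open Finset Matrix

variable {nr nc e r : ℕ}

/-- A minor of the 0/1 matching matrix of two injective index maps is the identity. -/
theorem submatrix_matching_eq_one (ρ : Fin e → Fin nr) (κ : Fin e → Fin nc)
    (hρ : Function.Injective ρ) (hκ : Function.Injective κ) :
    (Matrix.of fun a m => if ∃ q, ρ q = a ∧ κ q = m then (1 : ℂ) else 0).submatrix ρ κ = 1 := by
  ext q q'
  simp only [Matrix.submatrix_apply, Matrix.of_apply]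
  by_cases h : q = q'
  · subst h
    rw [if_pos ⟨q, rfl, rfl⟩, Matrix.one_apply_eq]
  · rw [Matrix.one_apply_ne h, if_neg]
    rintro ⟨q₀, h1, h2⟩
    exact h ((hρ h1).symm.trans (hκ h2))

/-- **Leaf (one row).** A configuration with a single row whose index maps are injective is ALIVE. -/
theorem alive_of_injective (R : Fin 1 → Fin e → Fin nr) (C : Fin 1 → Fin e → Fin nc)
    (hR : Function.Injective (R 0)) (hC : Function.Injective (C 0)) :
    ∃ G : Matrix (Fin nr) (Fin nc) ℂ,
      (Matrix.of fun i j : Fin 1 => (G.submatrix (R i) (C j)).det).det ≠ 0 := by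
  refine ⟨Matrix.of fun a m => if ∃ q, R 0 q = a ∧ C 0 q = m then (1 : ℂ) else 0, ?_⟩
  rw [Matrix.det_unique, Matrix.of_apply, Fin.default_eq_zero,
    submatrix_matching_eq_one (R 0) (C 0) hR hC, Matrix.det_one]
  exact one_ne_zero

/-- **Leaf (rank 0).** With empty index maps every minor is `1`; the layout matrix is the all-ones
matrix, nonsingular iff `r ≤ 1`. -/
theorem alive_rank_zero (R : Fin r → Fin 0 → Fin nr) (C : Fin r → Fin 0 → Fin nc) (hr : r ≤ 1) :
    ∃ G : Matrix (Fin nr) (Fin nc) ℂ,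
      (Matrix.of fun i j : Fin r => (G.submatrix (R i) (C j)).det).det ≠ 0 := by
  refine ⟨0, ?_⟩
  have hM : (Matrix.of fun i j : Fin r => ((0 : Matrix (Fin nr) (Fin nc) ℂ).submatrix (R i) (C j)).det)
      = Matrix.of fun _ _ : Fin r => (1 : ℂ) := by
    ext i j
    simp only [Matrix.of_apply, Matrix.det_isEmpty]
  rw [hM]
  rcases Nat.le_one_iff_eq_zero_or_eq_one.mp hr with rfl | rfl
  · simp only [Matrix.det_isEmpty, ne_eq, one_ne_zero, not_false_eq_true]
  · rw [Matrix.det_unique]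
    simp only [Matrix.of_apply, ne_eq, one_ne_zero, not_false_eq_true]

/-- **Leaf (rank 1).** With index maps on `Fin 1` the layout matrix is the minor
`G[(R i 0)_i, (C j 0)_j]`; if the row literals are distinct and the column literals are distinct it
is nonsingular for the matching matrix. -/
theorem alive_rank_one (R : Fin r → Fin 1 → Fin nr) (C : Fin r → Fin 1 → Fin nc)
    (hR : Function.Injective fun i => R i 0) (hC : Function.Injective fun j => C j 0) :
    ∃ G : Matrix (Fin nr) (Fin nc) ℂ,
      (Matrix.of fun i j : Fin r => (G.submatrix (R i) (C j)).det).det ≠ 0 := by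
  refine ⟨Matrix.of fun a m => if ∃ q, R q 0 = a ∧ C q 0 = m then (1 : ℂ) else 0, ?_⟩
  have hM : (Matrix.of fun i j : Fin r =>
      ((Matrix.of fun a m => if ∃ q, R q 0 = a ∧ C q 0 = m then (1 : ℂ) else 0).submatrix
        (R i) (C j)).det) =
      (Matrix.of fun a m => if ∃ q, R q 0 = a ∧ C q 0 = m then (1 : ℂ) else 0).submatrix
        (fun i => R i 0) (fun j => C j 0) := by
    ext i j
    rw [Matrix.of_apply, Matrix.det_unique, Matrix.submatrix_apply, Matrix.submatrix_apply,
      Fin.default_eq_zero]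
  rw [hM, submatrix_matching_eq_one (fun i => R i 0) (fun j => C j 0) hR hC, Matrix.det_one]
  exact one_ne_zero

/-- **Transpose symmetry.** Swapping the roles of rows and columns preserves aliveness
(`G ↦ Gᵀ`); so the column-pair move is `pairMove` applied to the transposed configuration. -/
theorem alive_transpose (R : Fin r → Fin e → Fin nr) (C : Fin r → Fin e → Fin nc)
    (h : ∃ G : Matrix (Fin nc) (Fin nr) ℂ,
      (Matrix.of fun i j : Fin r => (G.submatrix (C i) (R j)).det).det ≠ 0) :
    ∃ G : Matrix (Fin nr) (Fin nc) ℂ,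
      (Matrix.of fun i j : Fin r => (G.submatrix (R i) (C j)).det).det ≠ 0 := by
  obtain ⟨G, hG⟩ := h
  refine ⟨G.transpose, ?_⟩
  have hM : (Matrix.of fun i j : Fin r => (G.transpose.submatrix (R i) (C j)).det) =
      (Matrix.of fun i j : Fin r => (G.submatrix (C i) (R j)).det).transpose := by
    ext i j
    rw [Matrix.of_apply, Matrix.transpose_apply, Matrix.of_apply, ← Matrix.transpose_submatrix,
      Matrix.det_transpose]
  rw [hM, Matrix.det_transpose]
  exact hG

/-- **Re-indexing.** Permuting the rows and the columns of the layout (two permutations of `Fin r`)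
preserves aliveness. -/
theorem alive_reindex (R : Fin r → Fin e → Fin nr) (C : Fin r → Fin e → Fin nc)
    (σ τ : Equiv.Perm (Fin r))
    (h : ∃ G : Matrix (Fin nr) (Fin nc) ℂ,
      (Matrix.of fun i j : Fin r => (G.submatrix (R (σ i)) (C (τ j))).det).det ≠ 0) :
    ∃ G : Matrix (Fin nr) (Fin nc) ℂ,
      (Matrix.of fun i j : Fin r => (G.submatrix (R i) (C j)).det).det ≠ 0 := by
  obtain ⟨G, hG⟩ := h
  refine ⟨G, SplitGlue.det_ne_zero_of_submatrix_equiv _ σ τ ?_⟩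
  have hM : (Matrix.of fun i j : Fin r => (G.submatrix (R i) (C j)).det).submatrix σ τ =
      Matrix.of fun i j : Fin r => (G.submatrix (R (σ i)) (C (τ j))).det := by
    ext i j
    rfl
  rw [hM]
  exact hG

end Summit.ValiantsHypothesis.ValiantsHypothesis.Theorems.BarrierLever.PriorityPeeling
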